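import Literature.Probability.LatticeModels.GriffithsMonotonicity
import HarnessLib

/-!
# The Griffiths–Kelly–Sherman inequalities GKS I and GKS II (finite volume), proved

Topic `Probability/LatticeModels`; namespaces `Literature.StatMech` (the abstract inequalities for
ferromagnetic polynomial weights on `{−1,+1}^ι`) and `Literature.CritIsing` (the discharge of the
tree's named facts `gks_one`, `gks_two` of `CorrelationInequalities` for the nearest-neighbour
Ising measure `isingMeasure G Λ β h bc`, `bc ∈ {free, +}`, `β, h ≥ 0`, on any locally finite
graph).

The printed source followed is Friedli–Velenik 2017, §3.8.1 (proof of Theorem 3.20 =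
eqs. (3.21)–(3.22)), equivalently Kelly–Sherman, J. Math. Phys. **9** (1968) 466, Thms. 1–2,
Griffiths, J. Math. Phys. **8** (1967) 478/484, and Ginibre, Comm. Math. Phys. **16** (1970) 310:

* the Gibbs weight of a finite-volume ferromagnet is `exp(∑_C K_C ω_C)` with `K_C ≥ 0` and
  `ω_C = ∏_{i} ω_i^{n_C(i)}` (Friedli–Velenik (3.19)–(3.20); here monomials are indexed by
  exponent vectors `ι → ℕ`, which covers `σ_A σ_B` before reduction to `σ_{A ∆ B}`);
* **GKS I** (`sum_ferroMonomial_mul_ferroWeight_nonneg`): `∑_ω ω_A e^{∑ K_C ω_C} ≥ 0`, by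
  induction on the number of couplings, writing `e^{K ω_C} = cosh K + ω_C sinh K` (`ω_C = ±1`)
  and using `∑_ω ω^n = ∏_i (1 + (-1)^{n_i}) ≥ 0` (Friedli–Velenik (3.46)–(3.47));
* **GKS II** (`gks_two_ferro`): the duplicated-system argument (Friedli–Velenik (3.48)–(3.50),
  Ginibre): with `ω' = ω θ`,
  `Z²(⟨ω_Aω_B⟩ - ⟨ω_A⟩⟨ω_B⟩) = ∑_θ (1 - θ_B) ∑_ω ω_Aω_B e^{∑ K_C(1+θ_C) ω_C} ≥ 0` by GKS I for
  the nonnegative couplings `K_C (1 + θ_C)`;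
* the Ising specialisation (`gks_one_holds`, `gks_two_holds`): for `bc ∈ {free, +}` the spins
  outside `Λ` are `+1`, so `-β ℋ = β ∑_{edges} σ_uσ_v + βh ∑_x σ_x` is of the above form with
  couplings `β, βh ≥ 0` (boundary edges of the `+` condition contribute the one-body terms
  `β σ_u`), and `σ_A σ_B = σ_{A∆B}`.

## References

* S. Friedli, Y. Velenik, *Statistical Mechanics of Lattice Systems* (CUP 2017), Thm. 3.20 and
  §3.8.1 (proof), eqs. (3.19)–(3.22), (3.46)–(3.50).
* D. G. Kelly, S. Sherman, *General Griffiths' inequalities on correlations in Ising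
  ferromagnets*, J. Math. Phys. 9 (1968) 466–484 (bib key `KellySherman1968`).
* R. B. Griffiths, J. Math. Phys. 8 (1967) 478–483 and 484–489; J. Ginibre, Comm. Math. Phys.
  16 (1970) 310–328.
-/

noncomputable section

open MeasureTheory Filter Topology Finset Literature.Probability.LatticeModels Literature.Probability.Percolation

open scoped symmDiff

namespace Literature.Probability.LatticeModels

/-! ### Ferromagnetic polynomial weights on `{−1,+1}^ι` -/

section Ferro

variable {ι : Type*} [Fintype ι]

/-- The spin monomial `ω^c = ∏_i ω_i^{c i}` of an exponent vector `c : ι → ℕ`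
(Friedli–Velenik 2017, eq. (3.19): `ω_C`). [cite: FriedliVelenik2017, §3.6.1, eq. (3.19)] -/
def ferroMonomial (c : ι → ℕ) (ω : ι → ℤˣ) : ℝ :=
  ∏ i, ((ω i : ℤ) : ℝ) ^ c i

/-- The ferromagnetic polynomial Gibbs weight `exp(∑_{j ∈ s} K_j ω^{b_j})`
(Friedli–Velenik 2017, eq. (3.20)). [cite: FriedliVelenik2017, §3.6.1, eq. (3.20)] -/
def ferroWeight {J : Type*} (s : Finset J) (K : J → ℝ) (b : J → ι → ℕ) (ω : ι → ℤˣ) : ℝ :=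
  Real.exp (∑ j ∈ s, K j * ferroMonomial (b j) ω)

/-- A spin, as a real number, is `1` or `-1`. [folklore] -/
theorem units_coe_eq_one_or (u : ℤˣ) : ((u : ℤ) : ℝ) = 1 ∨ ((u : ℤ) : ℝ) = -1 := by
  rcases Int.units_eq_one_or u with h | h <;> simp [h]

/-- `ω^c ∈ {1, -1}`. [folklore] -/
theorem ferroMonomial_eq_one_or (c : ι → ℕ) (ω : ι → ℤˣ) :
    ferroMonomial c ω = 1 ∨ ferroMonomial c ω = -1 := by
  classical
  unfold ferroMonomial
  induction (Finset.univ : Finset ι) using Finset.induction_on with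
  | empty => simp
  | insert i s hi ih =>
    rw [Finset.prod_insert hi]
    have hpow : ((ω i : ℤ) : ℝ) ^ c i = 1 ∨ ((ω i : ℤ) : ℝ) ^ c i = -1 := by
      rcases units_coe_eq_one_or (ω i) with h | h
      · left; rw [h, one_pow]
      · rw [h]; exact neg_one_pow_eq_or ℝ (c i)
    rcases hpow with h1 | h1 <;> rcases ih with h2 | h2 <;> simp [h1, h2]

/-- `|ω^c| ≤ 1`, in the form `ω^c ≤ 1`. [folklore] -/
theorem ferroMonomial_le_one (c : ι → ℕ) (ω : ι → ℤˣ) : ferroMonomial c ω ≤ 1 := by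
  rcases ferroMonomial_eq_one_or c ω with h | h <;> simp [h]

/-- `ω^0 = 1`. [folklore] -/
@[simp] theorem ferroMonomial_zero (ω : ι → ℤˣ) : ferroMonomial (0 : ι → ℕ) ω = 1 := by
  simp [ferroMonomial]

/-- `ω^{c + c'} = ω^c ω^{c'}`. [folklore] -/
theorem ferroMonomial_add (c c' : ι → ℕ) (ω : ι → ℤˣ) :
    ferroMonomial (c + c') ω = ferroMonomial c ω * ferroMonomial c' ω := by
  simp only [ferroMonomial, Pi.add_apply, pow_add, Finset.prod_mul_distrib]

/-- `(ω θ)^c = ω^c θ^c`. [folklore] -/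
theorem ferroMonomial_mul (c : ι → ℕ) (ω θ : ι → ℤˣ) :
    ferroMonomial c (ω * θ) = ferroMonomial c ω * ferroMonomial c θ := by
  simp only [ferroMonomial, Pi.mul_apply, Units.val_mul, Int.cast_mul, mul_pow,
    Finset.prod_mul_distrib]

/-- `ω^{∑_{a ∈ A} c_a} = ∏_{a ∈ A} ω^{c_a}`. [folklore] -/
theorem ferroMonomial_sum {α : Type*} (A : Finset α) (c : α → ι → ℕ) (ω : ι → ℤˣ) :
    ferroMonomial (∑ a ∈ A, c a) ω = ∏ a ∈ A, ferroMonomial (c a) ω := by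
  classical
  induction A using Finset.induction_on with
  | empty => simp
  | insert a A ha ih => rw [Finset.sum_insert ha, Finset.prod_insert ha, ferroMonomial_add, ih]

/-- **`∑_ω ω^c = ∏_i (1 + (-1)^{c_i}) ≥ 0`** (Friedli–Velenik 2017, eq. (3.47): the sum over
configurations of a monomial factorises over sites, each factor being `0` or `2`). [cite: FriedliVelenik2017, §3.8.1, eq. (3.47)] -/
theorem sum_ferroMonomial_nonneg [DecidableEq ι] (c : ι → ℕ) : 0 ≤ ∑ ω : ι → ℤˣ, ferroMonomial c ω := by
  classical
  have h : ∑ ω : ι → ℤˣ, ferroMonomial c ω = ∏ i, ∑ u : ℤˣ, ((u : ℤ) : ℝ) ^ c i := by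
    simp only [ferroMonomial]
    rw [Finset.prod_univ_sum, Fintype.piFinset_univ]
  rw [h]
  refine Finset.prod_nonneg fun i _ => ?_
  rw [UnitsInt.univ, Finset.sum_pair (by decide)]
  simp only [Units.val_one, Int.cast_one, one_pow, Units.val_neg, Int.cast_neg]
  rcases neg_one_pow_eq_or ℝ (c i) with h1 | h1 <;> rw [h1] <;> norm_num

/-- `e^{K u} = cosh K + u sinh K` for `u = ±1`. [folklore] -/
theorem exp_mul_of_eq_one_or {u : ℝ} (hu : u = 1 ∨ u = -1) (K : ℝ) :
    Real.exp (K * u) = Real.cosh K + u * Real.sinh K := by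
  rcases hu with rfl | rfl
  · rw [mul_one, one_mul, Real.cosh_add_sinh]
  · rw [mul_neg_one, neg_one_mul, ← sub_eq_add_neg, Real.cosh_sub_sinh]

/-- **GKS I for ferromagnetic polynomial weights** (Friedli–Velenik 2017, eq. (3.21) / proof in
§3.8.1, eqs. (3.46)–(3.47); Kelly–Sherman 1968, Thm. 1; Griffiths 1967): for couplings
`K_j ≥ 0`, `∑_ω ω^a exp(∑_j K_j ω^{b_j}) ≥ 0` for every exponent vector `a`. Proof by induction on
the set of couplings: `e^{K ω^b} = cosh K + ω^b sinh K` splits the sum into two sums of the same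
form with one coupling less and nonnegative prefactors `cosh K`, `sinh K` (`K ≥ 0`); with no
coupling the sum is `∑_ω ω^a ≥ 0`. [cite: FriedliVelenik2017, Thm. 3.20, eq. (3.21) and §3.8.1] -/
theorem sum_ferroMonomial_mul_ferroWeight_nonneg [DecidableEq ι] {J : Type*} (s : Finset J)
    {K : J → ℝ} (hK : ∀ j ∈ s, 0 ≤ K j) (b : J → ι → ℕ) (a : ι → ℕ) :
    0 ≤ ∑ ω : ι → ℤˣ, ferroMonomial a ω * ferroWeight s K b ω := by
  classical
  induction s using Finset.induction_on generalizing a with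
  | empty =>
    simp only [ferroWeight, Finset.sum_empty, Real.exp_zero, mul_one]
    exact sum_ferroMonomial_nonneg a
  | insert j s hj ih =>
    have hKj : 0 ≤ K j := hK j (Finset.mem_insert_self j s)
    have hK' : ∀ j' ∈ s, 0 ≤ K j' := fun j' hj' => hK j' (Finset.mem_insert_of_mem hj')
    -- split off the coupling `j`
    have hsplit : ∀ ω : ι → ℤˣ, ferroMonomial a ω * ferroWeight (insert j s) K b ω =
        Real.cosh (K j) * (ferroMonomial a ω * ferroWeight s K b ω) +
          Real.sinh (K j) * (ferroMonomial (a + b j) ω * ferroWeight s K b ω) := by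
      intro ω
      rw [ferroWeight, Finset.sum_insert hj, Real.exp_add,
        exp_mul_of_eq_one_or (ferroMonomial_eq_one_or (b j) ω), ferroMonomial_add, ferroWeight]
      ring
    simp_rw [hsplit]
    rw [Finset.sum_add_distrib, ← Finset.mul_sum, ← Finset.mul_sum]
    exact add_nonneg (mul_nonneg (Real.cosh_pos _).le (ih hK' a))
      (mul_nonneg (Real.sinh_nonneg_iff.2 hKj) (ih hK' (a + b j)))

/-- The product of the weights of `ω` and of the flipped configuration `ω θ` is a ferromagnetic
weight in `ω` with couplings `K_j (1 + θ^{b_j}) ≥ 0` (Friedli–Velenik 2017, eq. (3.49)). [cite: FriedliVelenik2017, §3.8.1, eq. (3.49)] -/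
theorem ferroWeight_mul_ferroWeight_mul {J : Type*} (s : Finset J) (K : J → ℝ) (b : J → ι → ℕ)
    (ω θ : ι → ℤˣ) :
    ferroWeight s K b ω * ferroWeight s K b (ω * θ) =
      ferroWeight s (fun j => K j * (1 + ferroMonomial (b j) θ)) b ω := by
  rw [ferroWeight, ferroWeight, ferroWeight, ← Real.exp_add, ← Finset.sum_add_distrib]
  congr 1
  refine Finset.sum_congr rfl fun j _ => ?_
  rw [ferroMonomial_mul]
  ring

/-- **GKS II for ferromagnetic polynomial weights** (Friedli–Velenik 2017, eq. (3.22) / proof in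
§3.8.1, eqs. (3.48)–(3.50); Kelly–Sherman 1968, Thm. 2; Ginibre 1970): for couplings `K_j ≥ 0`
and exponent vectors `a, a'`, with `Z_c = ∑_ω ω^c e^{∑ K_j ω^{b_j}}`,
`Z_a Z_{a'} ≤ Z_{a+a'} Z_0`, i.e. `⟨ω^aω^{a'}⟩ ≥ ⟨ω^a⟩⟨ω^{a'}⟩`. Proof (duplicated spins):
substituting `ω' = ω θ` in the double sum,
`Z_{a+a'}Z_0 - Z_aZ_{a'} = ∑_θ (1 - θ^{a'}) ∑_ω ω^{a+a'} e^{∑ K_j(1+θ^{b_j}) ω^{b_j}} ≥ 0`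
by GKS I. [cite: FriedliVelenik2017, Thm. 3.20, eq. (3.22) and §3.8.1] -/
theorem gks_two_ferro [DecidableEq ι] {J : Type*} (s : Finset J) {K : J → ℝ}
    (hK : ∀ j ∈ s, 0 ≤ K j) (b : J → ι → ℕ) (a a' : ι → ℕ) :
    (∑ ω : ι → ℤˣ, ferroMonomial a ω * ferroWeight s K b ω) *
        (∑ ω : ι → ℤˣ, ferroMonomial a' ω * ferroWeight s K b ω) ≤
      (∑ ω : ι → ℤˣ, ferroMonomial (a + a') ω * ferroWeight s K b ω) *
        (∑ ω : ι → ℤˣ, ferroWeight s K b ω) := by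
  classical
  set W := ferroWeight s K b with hW
  -- reindex the second configuration as `ω * θ`
  have hre : ∀ (ω : ι → ℤˣ) (F : (ι → ℤˣ) → ℝ), ∑ ω' : ι → ℤˣ, F ω' = ∑ θ : ι → ℤˣ, F (ω * θ) :=
    fun ω F => (Equiv.sum_comp (Equiv.mulLeft ω) F).symm
  rw [← sub_nonneg, Finset.sum_mul_sum, Finset.sum_mul_sum, ← Finset.sum_sub_distrib]
  simp_rw [← Finset.sum_sub_distrib]
  -- rewrite each inner sum over `ω'` as a sum over `θ`
  have hinner : ∀ ω : ι → ℤˣ,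
      ∑ ω' : ι → ℤˣ, (ferroMonomial (a + a') ω * W ω * W ω' -
        ferroMonomial a ω * W ω * (ferroMonomial a' ω' * W ω')) =
      ∑ θ : ι → ℤˣ, (1 - ferroMonomial a' θ) * (ferroMonomial (a + a') ω *
        ferroWeight s (fun j => K j * (1 + ferroMonomial (b j) θ)) b ω) := by
    intro ω
    rw [hre ω]
    refine Finset.sum_congr rfl fun θ _ => ?_
    rw [← ferroWeight_mul_ferroWeight_mul, ferroMonomial_mul, ferroMonomial_add]
    ring
  simp_rw [hinner]
  rw [Finset.sum_comm]
  refine Finset.sum_nonneg fun θ _ => ?_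
  rw [← Finset.mul_sum]
  refine mul_nonneg ?_ (sum_ferroMonomial_mul_ferroWeight_nonneg s (fun j hj => ?_) b (a + a'))
  · have := ferroMonomial_le_one a' θ
    linarith
  · have h1 := hK j hj
    have h2 : 0 ≤ 1 + ferroMonomial (b j) θ := by
      rcases ferroMonomial_eq_one_or (b j) θ with h | h <;> rw [h] <;> norm_num
    exact mul_nonneg h1 h2

end Ferro

/-! ### The Ising weight with `+1` outside `Λ` as a ferromagnetic polynomial weight -/

section IsingFerro

variable {V : Type*} (G : SimpleGraph V) [DecidableEq V] [G.LocallyFinite]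
variable (Λ : Finset V)

/-- The exponent vector `δ_u` on `Λ` of a vertex `u` (zero if `u ∉ Λ`). [folklore] -/
def siteExp (u : V) : Λ → ℕ := fun x => if (x : V) = u then 1 else 0

/-- The exponent vector `δ_u + δ_v` of a bond `s(u, v)`. [folklore] -/
def bondExp : Sym2 V → Λ → ℕ :=
  Sym2.lift ⟨fun u v => siteExp Λ u + siteExp Λ v, fun _ _ => add_comm _ _⟩

/-- `bondExp Λ s(u,v) = δ_u + δ_v`. [folklore] -/
@[simp] theorem bondExp_mk (u v : V) : bondExp Λ s(u, v) = siteExp Λ u + siteExp Λ v := rfl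

/-- With `+1` outside `Λ`, the spin at `u` of a glued configuration is the monomial `ω^{δ_u}`
(equal to `1` if `u ∉ Λ`). [folklore] -/
theorem spinAt_glue_eq_ferroMonomial {bc : BoundaryCondition V} (hout : bc.outside = 1)
    (τ : Λ → ℤˣ) (u : V) : spinAt u (glue Λ τ bc) = ferroMonomial (siteExp Λ u) τ := by
  classical
  unfold ferroMonomial siteExp
  by_cases hu : u ∈ Λ
  · rw [Finset.prod_eq_single ⟨u, hu⟩]
    · simp [spinAt, glue_apply_of_mem Λ τ bc hu]
    · intro x _ hx
      have : (x : V) ≠ u := fun h => hx (Subtype.ext h)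
      simp [this]
    · intro h; exact absurd (Finset.mem_univ _) h
  · have h1 : ∀ x : Λ, ((x : V) = u) = False := fun x => by
      simp only [eq_iff_iff, iff_false]
      intro h; exact hu (h ▸ x.2)
    simp [spinAt, glue_apply_of_notMem Λ τ bc hu, hout, h1]

/-- With `+1` outside `Λ`, a spin product of a glued configuration is the monomial
`ω^{∑_{u∈A} δ_u}`. [folklore] -/
theorem spinProduct_glue_eq_ferroMonomial {bc : BoundaryCondition V} (hout : bc.outside = 1)
    (τ : Λ → ℤˣ) (A : Finset V) :
    spinProduct A (glue Λ τ bc) = ferroMonomial (∑ u ∈ A, siteExp Λ u) τ := by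
  rw [ferroMonomial_sum, spinProduct]
  exact Finset.prod_congr rfl fun u _ => spinAt_glue_eq_ferroMonomial Λ hout τ u

/-- The couplings of the Ising weight: `β` on bonds, `βh` on sites. [folklore] -/
def isingCoupling (β h : ℝ) : Sym2 V ⊕ V → ℝ
  | Sum.inl _ => β
  | Sum.inr _ => β * h

/-- The exponent vectors of the Ising weight: `δ_u + δ_v` on the bond `s(u,v)`, `δ_x` on the
site `x`. [folklore] -/
def isingExp : Sym2 V ⊕ V → Λ → ℕ
  | Sum.inl e => bondExp Λ e
  | Sum.inr x => siteExp Λ x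

/-- **The Ising Boltzmann weight is a ferromagnetic polynomial weight** when the spins outside
`Λ` are `+1` (free or `+` boundary condition): `-β ℋ^{bc}_{Λ;h}(glue τ) = ∑_j K_j ω^{b_j}` over
`j ∈ ℰ^{bc}_Λ ⊔ Λ` with `K = β` on bonds and `K = βh` on sites (Friedli–Velenik 2017, §3.6.1,
"the Ising model … can be written in the form (3.20)"). [cite: FriedliVelenik2017, §3.6.1] -/
theorem isingWeight_eq_ferroWeight {bc : BoundaryCondition V} (hout : bc.outside = 1) (β h : ℝ)
    (τ : Λ → ℤˣ) :
    isingWeight G Λ β h bc τ =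
      ferroWeight ((interactionEdges G Λ bc).disjSum Λ) (isingCoupling β h) (isingExp Λ) τ := by
  rw [isingWeight, ferroWeight]
  congr 1
  simp only [Finset.sum_disjSum, isingCoupling, isingExp]
  have hE : ∀ e ∈ interactionEdges G Λ bc, bondSpin (glue Λ τ bc) e = ferroMonomial (bondExp Λ e) τ := by
    intro e _
    induction e using Sym2.ind with
    | _ u v =>
      rw [bondSpin_mk, bondExp_mk, ferroMonomial_add, spinAt_glue_eq_ferroMonomial Λ hout,
        spinAt_glue_eq_ferroMonomial Λ hout]
  have hS : ∀ x ∈ Λ, spinAt x (glue Λ τ bc) = ferroMonomial (siteExp Λ x) τ := fun x _ =>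
    spinAt_glue_eq_ferroMonomial Λ hout τ x
  rw [isingHamiltonian, Finset.sum_congr rfl hE, Finset.sum_congr rfl hS, ← Finset.mul_sum,
    ← Finset.mul_sum]
  ring

omit [DecidableEq V] [G.LocallyFinite] in
/-- The Ising couplings are nonnegative for `β, h ≥ 0`. [folklore] -/
theorem isingCoupling_nonneg {β h : ℝ} (hβ : 0 ≤ β) (hh : 0 ≤ h) (j : Sym2 V ⊕ V) :
    0 ≤ isingCoupling (V := V) β h j := by
  cases j with
  | inl _ => exact hβ
  | inr _ => exact mul_nonneg hβ hh

omit [DecidableEq V] [G.LocallyFinite] in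
/-- For the free and the `+` boundary condition the spins outside `Λ` are `+1`. [folklore] -/
theorem outside_eq_one_of_free_or_plus {bc : BoundaryCondition V} (hbc : bc = .free ∨ bc = .plus) :
    bc.outside = 1 := by
  rcases hbc with rfl | rfl <;> rfl

end IsingFerro

end Literature.Probability.LatticeModels

namespace Literature.Probability.LatticeModels

open Percolation

variable {V : Type*} (G : SimpleGraph V) [DecidableEq V] [G.LocallyFinite]
variable {Λ A B : Finset V} {β h : ℝ} {bc : BoundaryCondition V}

/-- The numerator of `⟨σ_A⟩^{bc}_{Λ;β,h}` as a GKS sum. [folklore] -/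
theorem isingCorr_eq_ferro_div (hbc : bc = .free ∨ bc = .plus) (β h : ℝ) (Λ A : Finset V) :
    isingCorr G Λ β h bc A =
      (∑ τ : Λ → ℤˣ, ferroMonomial (∑ u ∈ A, siteExp Λ u) τ *
          ferroWeight ((interactionEdges G Λ bc).disjSum Λ) (isingCoupling β h) (isingExp Λ) τ) /
        isingPartitionFunction G Λ β h bc := by
  rw [isingCorr, isingExpect_eq_sum_div G Λ h bc β (measurable_spinProduct A)]
  congr 1
  refine Finset.sum_congr rfl fun τ _ => ?_
  rw [isingWeight_eq_ferroWeight G Λ (outside_eq_one_of_free_or_plus hbc),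
    spinProduct_glue_eq_ferroMonomial Λ (outside_eq_one_of_free_or_plus hbc), mul_comm]

/-- The partition function as a GKS sum. [folklore] -/
theorem isingPartitionFunction_eq_ferro (hbc : bc = .free ∨ bc = .plus) (β h : ℝ) (Λ : Finset V) :
    isingPartitionFunction G Λ β h bc =
      ∑ τ : Λ → ℤˣ, ferroWeight ((interactionEdges G Λ bc).disjSum Λ) (isingCoupling β h) (isingExp Λ) τ := by
  rw [isingPartitionFunction]
  exact Finset.sum_congr rfl fun τ _ =>
    isingWeight_eq_ferroWeight G Λ (outside_eq_one_of_free_or_plus hbc) β h τ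

/-- **GKS I for the finite-volume Ising model, proved** (the tree's named fact `gks_one`:
Friedli–Velenik 2017, Thm. 3.20, eq. (3.21); Griffiths 1967; Kelly–Sherman 1968): for
`β, h ≥ 0`, free or `+` boundary condition and `A ⊆ Λ`, `⟨σ_A⟩^{bc}_{Λ;β,h} ≥ 0`. [cite: FriedliVelenik2017, Thm. 3.20, eq. (3.21)] -/
theorem GriffithsKellySherman.gks_one_holds : gks_one G (Λ := Λ) (A := A) (β := β) (h := h) (bc := bc) := by
  intro hβ hh hbc _hA
  classical
  rw [isingCorr_eq_ferro_div G hbc]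
  refine div_nonneg ?_ (isingPartitionFunction_pos G Λ β h bc).le
  exact sum_ferroMonomial_mul_ferroWeight_nonneg ((interactionEdges G Λ bc).disjSum Λ)
    (fun j _ => isingCoupling_nonneg hβ hh j) (isingExp Λ) _

/-- **GKS II for the finite-volume Ising model, proved** (the tree's named fact `gks_two`:
Friedli–Velenik 2017, Thm. 3.20, eq. (3.22); Griffiths 1967; Kelly–Sherman 1968): for
`β, h ≥ 0`, free or `+` boundary condition and `A, B ⊆ Λ`,
`⟨σ_A⟩⟨σ_B⟩ ≤ ⟨σ_{A ∆ B}⟩ (= ⟨σ_Aσ_B⟩)`. [cite: FriedliVelenik2017, Thm. 3.20, eq. (3.22)] -/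
theorem GriffithsKellySherman.gks_two_holds : gks_two G (Λ := Λ) (A := A) (B := B) (β := β) (h := h) (bc := bc) := by
  intro hβ hh hbc _hA _hB
  classical
  have hout := outside_eq_one_of_free_or_plus hbc
  have hZ := isingPartitionFunction_pos G Λ β h bc
  -- `⟨σ_{A∆B}⟩ = ⟨σ_A σ_B⟩` has numerator `∑ ω^{a + a'} W`
  have hAB : isingCorr G Λ β h bc (A ∆ B) =
      (∑ τ : Λ → ℤˣ, ferroMonomial ((∑ u ∈ A, siteExp Λ u) + ∑ u ∈ B, siteExp Λ u) τ *
          ferroWeight ((interactionEdges G Λ bc).disjSum Λ) (isingCoupling β h) (isingExp Λ) τ) /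
        isingPartitionFunction G Λ β h bc := by
    have hobs : spinProduct (A ∆ B) = spinProduct A * spinProduct B :=
      funext fun σ => (spinProduct_mul_spinProduct A B σ).symm
    rw [isingCorr, hobs, isingExpect_eq_sum_div G Λ h bc β
      ((measurable_spinProduct A).mul (measurable_spinProduct B))]
    congr 1
    refine Finset.sum_congr rfl fun τ _ => ?_
    rw [Pi.mul_apply, isingWeight_eq_ferroWeight G Λ hout,
      spinProduct_glue_eq_ferroMonomial Λ hout, spinProduct_glue_eq_ferroMonomial Λ hout,
      ferroMonomial_add, mul_comm]
  have hineq : ∀ {Na Nb Nab Z : ℝ}, 0 < Z → Na * Nb ≤ Nab * Z → Na / Z * (Nb / Z) ≤ Nab / Z := by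
    intro Na Nb Nab Z hZ' hle
    rw [div_mul_div_comm, div_le_div_iff₀ (mul_pos hZ' hZ') hZ']
    nlinarith [mul_le_mul_of_nonneg_right hle hZ'.le]
  rw [hAB, isingCorr_eq_ferro_div G hbc β h Λ A, isingCorr_eq_ferro_div G hbc β h Λ B]
  refine hineq hZ ?_
  rw [isingPartitionFunction_eq_ferro G hbc]
  exact gks_two_ferro ((interactionEdges G Λ bc).disjSum Λ)
    (fun j _ => isingCoupling_nonneg hβ hh j) (isingExp Λ) _ _

end Literature.Probability.LatticeModels
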